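import Literature.AnabelianGeometry.SemiGraphs.ThetaRayGraphQuasiCoherent
import Literature.AnabelianGeometry.SemiGraphs.ThetaRayFreeProP
import Literature.AnabelianGeometry.SemiGraphs.FreeProPRankTwo
import Literature.GroupTheory.ProcyclicImageBridges
import HarnessLib

/-!
# (H4) + (H5) DISCHARGED at the free pro-`p` model of `𝒢_θ` — binder form over the gluing `α` and the
# twists `θ` (FRONTIER programme SUBDAG-REFUTE-F1732, brick R4c)

S. Mochizuki, *Semi-graphs of anabelioids*, Publ. RIMS **42** (2006), Def. 2.3 (iii) p. 25 (quasi-coherent),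
[IUTchI] Rmk. 2.5.3 (i) (T2)–(T4) pp. 52–53 (Galois-countable, strictly coherent)
[cite: MochizukiSemiAnbd2006, Def 2.3(iii) p.25], for the concrete countermodel candidate
`𝒢_θ = thetaRayOfTwists F̂₂⁽ᵖ⁾ ℤ_p α θ n` of abc-iut-L3-d1 (memo 8b26b5199c29f55f §3 (H4)/(H5)): vertex groups
the free pro-`p` group of rank two `F̂₂⁽ᵖ⁾ = FreeProPRankTwo.Grp p` (brick R1: topologically generated by
`a, b`; continuous character `χa` with `χa a = 1`), edge groups `ℤ_p` (`Multiplicative ℤ_[p]`), upper gluing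
`α : ℤ_p → F̂₂⁽ᵖ⁾` with `α(1) = a`, lower gluings `θ_{n_k} ∘ α` for continuous BIJECTIVE endomorphisms `θ_m`
(brick R1 part 2 supplies `α`, `θ_m` as TERMS — `ContinuousMulEquiv`s; here they are BINDERS with exactly the
properties used: `α (ofAdd 1) = a` and bijectivity).

This PROOF-ONLY file (abc-iut-w4-d075; 0 defs) closes the two hypothesis binders `hGC` / `hQC` of
`thetaRayOfTwists_thm37Hypotheses` (`ThetaRayGraphHypotheses.lean`, brick R3) at that model from LANDED
theorems only — `thetaRayOfTwists_isQuasiCoherent_isGaloisCountable` (`ThetaRayGraphQuasiCoherent.lean`,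
brick R4) fed with: R1's `exists_generating_finset` (two topological generators of `F̂₂⁽ᵖ⁾`), the density of
`ℤ` in `ℤ_p` (`PadicInt.topologicalClosure_zpowers_ofAdd_one`), the retraction `χa ∘ α = id` (from
`α(1) = a`, `χa a = 1` and uniqueness of continuous homomorphisms out of `ℤ_p`, abc-iut-w6-d102's
`ext_of_apply_ofAdd_one`), and the bijectivity of the `θ_m` (inverse continuity is automatic: `F̂₂⁽ᵖ⁾` is
compact Hausdorff).  Also the SPLITTER FAMILY of the model (`thetaRayFreeProP_exists_splitter`, for brick R6).
HONEST FRAMING: hypotheses of a countermodel CANDIDATE to the ∀-countable typing of [SemiAnbd] Thm 3.7 (iii)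
(F-1732); print proves the finite case (kernel: `compactInVerticialAt_of_finiteGraph`); nothing here bears on
[IUTchIII] Cor. 3.12 or on the IUT papers (finite dual graphs only); typed ≠ proved.
-/

namespace Literature.AnabelianGeometry.SemiGraphs

namespace ProfiniteSemiGraph

open Topology Multiplicative
open Literature.AnabelianGeometry.SemiGraphs.FreeProPRankTwo

section Model

variable (p : ℕ) [hp : Fact p.Prime]

/-- `ℤ_p` (multiplicative notation) is topologically generated by `{1}` — the `Finset` form of
`PadicInt.topologicalClosure_zpowers_ofAdd_one` wanted by `IsStrictlyCoherent.exists_bound`.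
[cite: Mochizuki2012, IUTchI Rem. 2.5.3(i)(T3) p.53] -/
theorem padicInt_topologicalClosure_closure_ofAdd_one :
    (Subgroup.closure ({ofAdd (1 : ℤ_[p])} : Set (Multiplicative ℤ_[p]))).topologicalClosure = ⊤ := by
  rw [← Subgroup.zpowers_eq_closure]
  exact PadicInt.topologicalClosure_zpowers_ofAdd_one

variable (α : Multiplicative ℤ_[p] →ₜ* Grp p) (hα1 : α (ofAdd 1) = a p)
variable (θ : ℕ → (Grp p →ₜ* Grp p)) (hθ : ∀ m, Function.Bijective (θ m)) (n : ℕ → ℕ)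

include hα1 in
/-- **`χa` is a continuous retraction of the gluing `α`**: `χa (α t) = t` (both sides are continuous
homomorphisms out of `ℤ_p` agreeing at `1`, since `α(1) = a` and `χa a = 1`).
[cite: MochizukiSemiAnbd2006, Def 2.1 p.22] -/
theorem χa_α_apply (t : Multiplicative ℤ_[p]) : χa p (α t) = t := by
  have h : (χa p).toMonoidHom.comp α.toMonoidHom = MonoidHom.id (Multiplicative ℤ_[p]) :=
    ext_of_apply_ofAdd_one p ((map_continuous (χa p)).comp (map_continuous α)) continuous_id (by
      change χa p (α (ofAdd 1)) = ofAdd 1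
      rw [hα1, χa_a])
  exact DFunLike.congr_fun h t

include hα1 hθ in
/-- **(H5) ∧ (T3) ∧ (H4) at the free pro-`p` model of `𝒢_θ`**: quasi-coherent, strictly coherent and
Galois-countable. [cite: Mochizuki2012, IUTchI Rem. 2.5.3(i)(T4) p.53] -/
theorem thetaRayFreeProP_isQuasiCoherent_isGaloisCountable :
    (thetaRayOfTwists (Grp p) (Multiplicative ℤ_[p]) α θ n).IsQuasiCoherent ∧
      (thetaRayOfTwists (Grp p) (Multiplicative ℤ_[p]) α θ n).IsStrictlyCoherent ∧
      (thetaRayOfTwists (Grp p) (Multiplicative ℤ_[p]) α θ n).IsGaloisCountable := by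
  classical
  obtain ⟨sG, -, hsG⟩ := exists_generating_finset p
  exact thetaRayOfTwists_isQuasiCoherent_isGaloisCountable (Grp p) (Multiplicative ℤ_[p]) α θ n sG hsG
    {ofAdd (1 : ℤ_[p])} (by rw [Finset.coe_singleton]; exact padicInt_topologicalClosure_closure_ofAdd_one p)
    (χa p).toMonoidHom (map_continuous (χa p)) (χa_α_apply p α hα1) (fun k => hθ (n k))

include hα1 hθ in
/-- **(H5)** `𝒢_θ` (free pro-`p` model) is quasi-coherent. [cite: MochizukiSemiAnbd2006, Def 2.3(iii) p.25] -/
theorem thetaRayFreeProP_isQuasiCoherent :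
    (thetaRayOfTwists (Grp p) (Multiplicative ℤ_[p]) α θ n).IsQuasiCoherent :=
  (thetaRayFreeProP_isQuasiCoherent_isGaloisCountable p α hα1 θ hθ n).1

include hα1 hθ in
/-- **(T3)** `𝒢_θ` (free pro-`p` model) is strictly coherent. [cite: Mochizuki2012, IUTchI Rem. 2.5.3(i)(T3) p.53] -/
theorem thetaRayFreeProP_isStrictlyCoherent :
    (thetaRayOfTwists (Grp p) (Multiplicative ℤ_[p]) α θ n).IsStrictlyCoherent :=
  (thetaRayFreeProP_isQuasiCoherent_isGaloisCountable p α hα1 θ hθ n).2.1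

include hα1 hθ in
/-- **(H4)** `𝒢_θ` (free pro-`p` model) is Galois-countable. [cite: Mochizuki2012, IUTchI Rem. 2.5.3(i)(T2) p.52] -/
theorem thetaRayFreeProP_isGaloisCountable :
    (thetaRayOfTwists (Grp p) (Multiplicative ℤ_[p]) α θ n).IsGaloisCountable :=
  (thetaRayFreeProP_isQuasiCoherent_isGaloisCountable p α hα1 θ hθ n).2.2

include hθ in
/-- **The splitter family of the model** (for the escape brick R6): for every `M` a finite covering of `𝒢_θ`
with nonempty fibres whose point stabilisers are EXACTLY the characteristic open core `charOpenCore F̂₂⁽ᵖ⁾ M`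
at every vertex and `α⁻¹(charOpenCore F̂₂⁽ᵖ⁾ M)` at every edge. [cite: MochizukiSemiAnbd2006, Prop 2.5 p.27] -/
theorem thetaRayFreeProP_exists_splitter (M : ℕ) :
    ∃ S : CovObj (thetaRayOfTwists (Grp p) (Multiplicative ℤ_[p]) α θ n), S.IsFinite ∧ S.HasNonemptyFibres ∧
      (∀ (v : ℕ) (z : (S.SV v).obj.V) (g : Grp p), (S.SV v).obj.ρ g z = z ↔ g ∈ charOpenCore (Grp p) M) ∧
      (∀ (e : ℕ) (z : (S.SE e).obj.V) (g : Multiplicative ℤ_[p]),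
        (S.SE e).obj.ρ g z = z ↔ g ∈ (charOpenCore (Grp p) M).comap α.toMonoidHom) :=
  thetaRayOfTwists_exists_splitter (Grp p) (Multiplicative ℤ_[p]) α θ n (isTopologicallyFinitelyGenerated p)
    (fun k => hθ (n k)) M

end Model

end ProfiniteSemiGraph

end Literature.AnabelianGeometry.SemiGraphs
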